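import Summits.HubbardSuperconductivity.HubbardLadder.PairCorrWindowOfOpBounds
import Literature.MathematicalPhysics.QuantumLattice.HubbardNNNHoppingPairCorrelatorCertificate
import HarnessLib

/-!
# R3-∞ / R4 soundness edge: ONE translation-invariant window certificate ⇒ certified pair-correlator
# rows on EVERY large torus (uniform in `L`), and the typed thermodynamic-limit targets it feeds

HONEST FRAMING: ladder R1–R4 with certified numbers; no claim on H/H₀.

What a thermodynamic-limit (TL) statement needs, typed (cell brief R4 (ii)). The finite-size rows of
rung R3 (`PairCorrWindowCert H N L r`, one per `(L, r)`, from an ED enclosure or a per-`L` SDP window)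
do not add up to a statement about `L → ∞`. A TL statement needs bounds UNIFORM IN `L`; the only
engine in the tree that produces them is the translation-invariant (window / "bootstrap") relaxation
with an energy constraint: ONE operator identity in the algebra of a finite window `Λ' ⊆ ℤ²`
(SOS + commutators with the local `t–t'` Hamiltonian + translation defects + charged words +
anti-Hermitian parts + residual words, Literature `re_orbitState_ge_of_window_certificate_d4_TT'_ineq`,
Wang et al. 2024 §III / Han 2020 §3) is valid on every torus into which the window fits, for every
filling, and — read in the translation-averaged vector state — for EVERY vector of a degenerate ground
level (Literature `re_pairCorrSum_groundState_ge_of_window_certificate_TT'`).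

This file packages that engine for the ladder:

* §1 `PairWindowCertTT' t t' U r ε` — the DATA of such a certificate for the signed
  `d_{x²-y²}` pair objective `ε · Δ_0† Δ_r` (`ε = 1`: lower bound on `P̄_d(r)`; `ε = -1`: upper bound),
  every hypothesis an explicit field (windows and inclusions, energy ceiling `u` with weight `κ ≥ 0`,
  density multipliers `μ_σ, ν`, SOS / eom / translation-defect / charged-word / anti-Hermitian /
  residual data, constant `c`, and the identity `hcert`); `bound L n = (c − Σ‖aₖ‖) + (Σ_σ μ_σ)(n/L² − ν)`
  is the certified number.
* §2 `bound_le` — soundness on every torus: `L ≥ 3`, window fits (`x ↦ x mod L` injective on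
  `thicken Λ' 1`), `n ≤ |𝕋_L|` pairs, `groundEnergy (hubbardTorusTT' L t t' U) (2n) ≤ u L²` ⇒ for every
  unit ground state `ψ` of the sector `(2n, S^z = 0)`: `bound L n ≤ ε · P̄_d(L, r; ψ)`.
* §3 `rowOfCertificates` — a lower (`ε = 1`) and an upper (`ε = -1`) certificate give the R3 row
  `PairCorrWindowCert (fun L => hubbardTorusTT' L t t' U) N L r` with window
  `[bound_lo L n, −bound_hi L n]`; `rows_eventually` — the SAME two certificates give such a row on
  EVERY side `L ≥ L₁` ("R3-∞ table": one certificate, all sizes), given a uniform energy ceiling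
  `E₀(N L)/L² ≤ min u_lo u_hi` for `L ≥ L₀`.
* The typed thermodynamic-limit TARGETS fed by these rows (`R3InfinityPositiveRowCert`,
  `R3InfinityDichotomyCert`, OPEN) and the discharge of the energy-ceiling hypothesis from the TL energy
  density are in `PairCorrWindowUniformTargets.lean`.

Result line (cell brief (iii)), exactly: no certificate instance has been run; nothing is certified at
any size by this file; it is the soundness edge and the typed targets only.

References: Wang et al., PRX 14 (2024) 031006 §III [cite: WangEtAl2024, §III]; Han, arXiv:2006.06002
§3 [cite: Han2020Bootstrap, §3]; Qin et al., PRX 10 (2020) 031016 §II [cite: QinEtAl2020, §II eqs. (2)–(4)];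
Scalapino, Phys. Rep. 250 (1995) 329 §2 [cite: Scalapino1995, §2 eq. (2.4)].
-/

namespace Summit.HubbardSuperconductivity.HubbardLadder

open Matrix Finset Filter Literature.Probability.LatticeModels
  Literature.MathematicalPhysics.QuantumLattice
open Literature.MathematicalPhysics.QuantumManyBody.StateRelaxation
open scoped ComplexOrder

noncomputable section

/-! ## §1 The data of a translation-reduced `t–t'` window certificate for `ε · Δ_0† Δ_r` -/

/-- **A translation-invariant window certificate for the signed `d`-wave pair objective
`ε · Δ_0† Δ_r`** in the `t–t'` Hubbard model `(t, t', U)` — the correlator analogue of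
`Bounds.D4WindowCertTT'` (same field layout where they overlap): windows `Λ ⊆ Λ' ⊆ ℤ²` carrying the
commutator generators and the objective, the energy constraint `κ (u·1 − E^{tt'}_Φ)` with `κ ≥ 0` and
ceiling `u` per site (Wang et al. 2024 §III), density multipliers `μ_σ (n_{0σ} − ν)`, the SOS / Gram
part, equation-of-motion multipliers `[H^{tt'}_{Λ'}, B_k]`, TRANSLATION identification terms
`Γ(τ_w) Y − Y` (no point group: the bound must hold for every vector of a degenerate ground level, whose
translation-averaged state need not be `D₄`-invariant), charged words, anti-Hermitian parts, residual
words `a_k v_k`, the constant `c`, and the identity `hcert` in the CAR algebra of the window. Every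
hypothesis of the soundness theorem is a field; nothing about the Hubbard ground state is assumed.
[cite: WangEtAl2024, §III] [cite: Han2020Bootstrap, §3] -/
structure PairWindowCertTT' (t t' U : ℝ) (r : Site 2) (ε : ℝ) where
  /-- inner window `Λ` (supports of the eom multipliers and identification terms) and outer window `Λ'` -/
  Λ : Finset (Site 2)
  Λ' : Finset (Site 2)
  hΛ : Λ ⊆ Λ'
  h8 : thicken Λ 1 ⊆ Λ'
  h0 : thicken ({0} : Finset (Site 2)) 1 ⊆ Λ'
  hz : (0 : Site 2) ∈ Λ'
  /-- the objective's pair regions lie in the window -/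
  hp0 : pairRegion (insert 0 unitSteps) 0 ⊆ Λ'
  hpr : pairRegion (insert 0 unitSteps) r ⊆ Λ'
  /-- energy constraint: weight `κ ≥ 0` and ceiling `u` (`E₀/L² ≤ u` is supplied per torus) -/
  κ : ℝ
  κ_nonneg : 0 ≤ κ
  u : ℝ
  /-- density multipliers `μ_σ (n_{0σ} − ν·1)` -/
  μ : Fin 2 → ℝ
  ν : ℝ
  /-- the SOS / Gram part -/
  m : ℕ
  Λm : Matrix (Fin m) (Fin m) ℂ
  hΛm : Λm.PosSemidef
  O : Fin m → FermionOp Λ'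
  /-- equation-of-motion multipliers `[H^{tt'}_{Λ'}, B_k]` -/
  k₁ : ℕ
  B : Fin k₁ → FermionOp Λ
  /-- translation identification terms `Γ(τ_w) Y − Y` -/
  k₂ : ℕ
  wv : Fin k₂ → Site 2
  hsh : ∀ l, d4ShiftSet 1 (wv l) Λ ⊆ Λ'
  Y : Fin k₂ → FermionOp Λ
  /-- charge / spin-charge ladder words -/
  k₃ : ℕ
  b : Fin k₃ → ℂ
  cw : Fin k₃ → List (Orb (PolySite Λ') × Bool)
  hcw : ∀ j, ladderCharge (cw j) ≠ 0 ∨ ladderSpinCharge (cw j) ≠ 0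
  /-- anti-Hermitian parts -/
  k₄ : ℕ
  dc : Fin k₄ → ℝ
  V : Fin k₄ → FermionOp Λ'
  /-- residual words with their coefficients, and the constant `c` -/
  k₅ : ℕ
  a : Fin k₅ → ℂ
  word : Fin k₅ → List (Orb (PolySite Λ') × Bool)
  c : ℝ
  /-- the certificate identity in the CAR algebra of the window -/
  hcert : ((ε : ℝ) : ℂ) • windowPairCorrObs (insert 0 unitSteps) dWaveFormFactor r hp0 hpr - (c : ℂ) • (1 : FermionOp Λ') -
        ∑ σ : Fin 2, ((μ σ : ℝ) : ℂ) • (nAt 0 hz σ - ((ν : ℝ) : ℂ) • (1 : FermionOp Λ')) -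
        ((κ : ℝ) : ℂ) • (((u : ℝ) : ℂ) • (1 : FermionOp Λ') -
          fermionEmbed (PolySite.incl h0) ((hubbardTTPrimeFermionInteraction t t' U).meanEnergyObs 1)) =
      gramForm Λm O +
        (∑ k ∈ univ, ((hubbardTTPrimeFermionInteraction t t' U).localHamiltonian Λ' * fermionEmbed (PolySite.incl hΛ) (B k) -
            fermionEmbed (PolySite.incl hΛ) (B k) * (hubbardTTPrimeFermionInteraction t t' U).localHamiltonian Λ') +
          ∑ l ∈ univ, (fermionEmbed (PolySite.incl (hsh l)) (fermionEmbed (PolySite.d4Emb 1 (wv l) Λ) (Y l)) -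
            fermionEmbed (PolySite.incl hΛ) (Y l)) +
          ∑ j ∈ univ, b j • ladderWord (cw j)) +
        (∑ m' ∈ univ, ((dc m' : ℝ) : ℂ) • ((V m')ᴴ - V m') + ∑ k ∈ univ, a k • ladderWord (word k))

namespace PairWindowCertTT'

variable {t t' U : ℝ} {r : Site 2} {ε : ℝ}

/-- The certificate's constant net of the residual mass: `q = c − Σₖ ‖aₖ‖`. [cite: Han2020Bootstrap, §3] -/
def q (C : PairWindowCertTT' t t' U r ε) : ℝ := C.c - ∑ k, ‖C.a k‖

/-- **The certified number** on the torus of side `L` at `n` pairs: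
`bound L n = q + (Σ_σ μ_σ)(n/L² − ν)`. [cite: WangEtAl2024, §III] -/
def bound (C : PairWindowCertTT' t t' U r ε) (L n : ℕ) : ℝ :=
  C.q + (∑ σ : Fin 2, C.μ σ) * ((n : ℝ) / (L : ℝ) ^ 2 - C.ν)

/-! ## §2 Soundness on every torus -/

/-- **Soundness, uniform in `L`.** For every `L ≥ 3` into which the window fits, every `n ≤ |𝕋_L|`
with `groundEnergy (hubbardTorusTT' L t t' U) (2n) / L² ≤ u`, and EVERY unit ground state `ψ` of the
sector `(2n, S^z = 0)` (degenerate levels included):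
`bound L n ≤ ε · Re ⟨ψ, O_r ψ⟩ / L²` (`O_r = pairCorrOp L r = Σ_x Δ_x† Δ_{x+r}`; `= ε · P̄_d(L, r; ψ)`).
(Literature `re_orbitState_ge_of_window_certificate_d4_TT'_groundState` with the trivial point group,
`fermionEmbed_toTorusEmb_windowPairCorrObs_localPair`, `re_orbitState_localPair_corr_eq_div`.)
[cite: WangEtAl2024, §III] -/
theorem bound_le (C : PairWindowCertTT' t t' U r ε) {L : ℕ} [NeZero L] (hL : 3 ≤ L)
    (hInj : Set.InjOn (Torus.proj (d := 2) L) ↑(thicken C.Λ' 1)) {n : ℕ}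
    (hn : n ≤ Fintype.card (FermionTorus 2 L))
    (hu : groundEnergy (hubbardTorusTT' L t t' U) (2 * n) / (L : ℝ) ^ 2 ≤ C.u)
    {ψ : Fock (Orb (FermionTorus 2 L))} (hGS : IsGroundStateInSector (hubbardTorusTT' L t t' U) (2 * n) 0 ψ)
    (hψ1 : star ψ ⬝ᵥ ψ = 1) :
    C.bound L n ≤ ε * ((star ψ ⬝ᵥ pairCorrOp L r *ᵥ ψ).re / (L : ℝ) ^ 2) := by
  have hInj' : Set.InjOn (Torus.proj (d := 2) L) ↑C.Λ' :=
    hInj.mono (by exact_mod_cast subset_thicken C.Λ' 1)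
  have h := re_orbitState_ge_of_window_certificate_d4_TT'_groundState t t' U hL hn C.hΛ C.h8 C.h0 C.hz hInj
    hInj' (S := ({1} : Finset (DihedralGroup 4))) (Finset.mem_singleton_self _)
    (fun a ha b hb => by
      rw [Finset.mem_singleton] at ha hb ⊢
      rw [ha, hb, one_mul])
    hGS hψ1 C.κ_nonneg hu
    (((ε : ℝ) : ℂ) • windowPairCorrObs (insert 0 unitSteps) dWaveFormFactor r C.hp0 C.hpr) C.μ C.ν C.hΛm C.O
    univ C.B univ (fun _ => 1) (fun _ _ => Finset.mem_singleton_self _) C.wv C.hsh C.Y univ C.b C.cw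
    (fun j _ => C.hcw j) univ C.dc C.V univ C.a C.word C.hcert
  rw [fermionEmbed_smul, LinearMap.map_smul, fermionEmbed_toTorusEmb_windowPairCorrObs_localPair, smul_eq_mul,
    Complex.re_ofReal_mul, re_orbitState_localPair_corr_eq_div] at h
  rw [pairCorrOp]
  exact h

/-- Soundness restated on `avgPairCorr` (the R3 table's quantity): `bound L n ≤ ε · P̄_d(L, r; ψ)`.
[cite: QinEtAl2020, §II eqs. (2)–(4)] -/
theorem bound_le_avgPairCorr (C : PairWindowCertTT' t t' U r ε) (m : ℕ) (hL : 3 ≤ m + 1)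
    (hInj : Set.InjOn (Torus.proj (d := 2) (m + 1)) ↑(thicken C.Λ' 1)) {n : ℕ}
    (hn : n ≤ Fintype.card (FermionTorus 2 (m + 1)))
    (hu : groundEnergy (hubbardTorusTT' (m + 1) t t' U) (2 * n) / ((m + 1 : ℕ) : ℝ) ^ 2 ≤ C.u)
    {ψ : Fock (Orb (FermionTorus 2 (m + 1)))}
    (hGS : IsGroundStateInSector (hubbardTorusTT' (m + 1) t t' U) (2 * n) 0 ψ) (hψ1 : star ψ ⬝ᵥ ψ = 1) :
    C.bound (m + 1) n ≤ ε * avgPairCorr (m + 1) r ψ := by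
  rw [avgPairCorr_eq_re_expect_pairCorrOp]
  exact C.bound_le hL hInj hn hu hGS hψ1

end PairWindowCertTT'

/-! ## §3 Rows from certificates: one side, and all large sides at once -/

/-- **R3 row from a lower and an upper certificate** on the torus of side `m + 1 ≥ 3`: window
`[bound_lo, −bound_hi]` for `P̄_d(m+1, r; ψ)` over every unit ground state of the sector
`(N (m+1) = 2n, S^z = 0)` of `hubbardTorusTT' (m+1) t t' U`. [cite: QinEtAl2020, §II eqs. (2)–(4)] -/
def rowOfCertificates {t t' U : ℝ} {r : Site 2} (Clo : PairWindowCertTT' t t' U r 1)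
    (Chi : PairWindowCertTT' t t' U r (-1)) (m : ℕ) (hL : 3 ≤ m + 1)
    (hInj₁ : Set.InjOn (Torus.proj (d := 2) (m + 1)) ↑(thicken Clo.Λ' 1))
    (hInj₂ : Set.InjOn (Torus.proj (d := 2) (m + 1)) ↑(thicken Chi.Λ' 1))
    {N : ℕ → ℕ} {n : ℕ} (hN : N (m + 1) = 2 * n) (hn : n ≤ Fintype.card (FermionTorus 2 (m + 1)))
    (hu₁ : groundEnergy (hubbardTorusTT' (m + 1) t t' U) (2 * n) / ((m + 1 : ℕ) : ℝ) ^ 2 ≤ Clo.u)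
    (hu₂ : groundEnergy (hubbardTorusTT' (m + 1) t t' U) (2 * n) / ((m + 1 : ℕ) : ℝ) ^ 2 ≤ Chi.u) :
    PairCorrWindowCert (fun L => hubbardTorusTT' L t t' U) N (m + 1) r :=
  PairCorrWindowCert.ofPairCorrOpBounds (H := fun L => hubbardTorusTT' L t t' U) (N := N) m r
    (Clo.bound (m + 1) n * ((m + 1 : ℕ) : ℝ) ^ 2) (-(Chi.bound (m + 1) n * ((m + 1 : ℕ) : ℝ) ^ 2))
    (fun ψ h1 hgs => by
      have hgs' : IsGroundStateInSector (hubbardTorusTT' (m + 1) t t' U) (2 * n) 0 ψ := by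
        rw [← hN]; exact hgs
      have hb := Clo.bound_le hL hInj₁ hn hu₁ hgs' h1
      have hL2 : (0 : ℝ) < ((m + 1 : ℕ) : ℝ) ^ 2 := by positivity
      rw [one_mul, le_div_iff₀ hL2] at hb
      exact hb)
    (fun ψ h1 hgs => by
      have hgs' : IsGroundStateInSector (hubbardTorusTT' (m + 1) t t' U) (2 * n) 0 ψ := by
        rw [← hN]; exact hgs
      have hb := Chi.bound_le hL hInj₂ hn hu₂ hgs' h1
      have hL2 : (0 : ℝ) < ((m + 1 : ℕ) : ℝ) ^ 2 := by positivity
      rw [neg_one_mul] at hb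
      have h' : (star ψ ⬝ᵥ pairCorrOp (m + 1) r *ᵥ ψ).re / ((m + 1 : ℕ) : ℝ) ^ 2 ≤ -Chi.bound (m + 1) n := by
        linarith
      rw [div_le_iff₀ hL2] at h'
      linarith)

/-- The endpoints of `rowOfCertificates`: `lo = bound_lo (m+1) n`, `hi = −bound_hi (m+1) n`. [folklore] -/
theorem rowOfCertificates_lo_hi {t t' U : ℝ} {r : Site 2} (Clo : PairWindowCertTT' t t' U r 1)
    (Chi : PairWindowCertTT' t t' U r (-1)) (m : ℕ) (hL : 3 ≤ m + 1)
    (hInj₁ : Set.InjOn (Torus.proj (d := 2) (m + 1)) ↑(thicken Clo.Λ' 1))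
    (hInj₂ : Set.InjOn (Torus.proj (d := 2) (m + 1)) ↑(thicken Chi.Λ' 1))
    {N : ℕ → ℕ} {n : ℕ} (hN : N (m + 1) = 2 * n) (hn : n ≤ Fintype.card (FermionTorus 2 (m + 1)))
    (hu₁ : groundEnergy (hubbardTorusTT' (m + 1) t t' U) (2 * n) / ((m + 1 : ℕ) : ℝ) ^ 2 ≤ Clo.u)
    (hu₂ : groundEnergy (hubbardTorusTT' (m + 1) t t' U) (2 * n) / ((m + 1 : ℕ) : ℝ) ^ 2 ≤ Chi.u) :
    (rowOfCertificates Clo Chi m hL hInj₁ hInj₂ hN hn hu₁ hu₂).lo = Clo.bound (m + 1) n ∧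
      (rowOfCertificates Clo Chi m hL hInj₁ hInj₂ hN hn hu₁ hu₂).hi = -Chi.bound (m + 1) n := by
  have hL2 : ((m + 1 : ℕ) : ℝ) ^ 2 ≠ 0 := by positivity
  obtain ⟨h1, h2⟩ := PairCorrWindowCert.ofPairCorrOpBounds_lo_hi (H := fun L => hubbardTorusTT' L t t' U) (N := N)
    m r (Clo.bound (m + 1) n * ((m + 1 : ℕ) : ℝ) ^ 2) (-(Chi.bound (m + 1) n * ((m + 1 : ℕ) : ℝ) ^ 2))
    _ _
  refine ⟨?_, ?_⟩
  · show (PairCorrWindowCert.ofPairCorrOpBounds _ _ _ _ _ _).lo = _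
    rw [h1, mul_div_cancel_right₀ _ hL2]
  · show (PairCorrWindowCert.ofPairCorrOpBounds _ _ _ _ _ _).hi = _
    rw [h2, neg_div, mul_div_cancel_right₀ _ hL2]

/-- **R3-∞ table: ONE pair of certificates gives a certified row on EVERY large torus.** Given a
lower and an upper certificate, a pair-number function `nOf` with `N L = 2 · nOf L ≤ 2|𝕋_L|`, and a
uniform energy ceiling `E₀(N L)/L² ≤ min u_lo u_hi` from `L₀` on (certifiable per `L` by a trial
state, `minEnergyOn_le_of_trialState`, and from `L₀` on by any number above the TL energy density —
`PairCorrWindowUniformTargets.uniformEnergyCeiling_of_energyDensityTT'_lt`), there is `L₁` such that every side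
`m + 1 ≥ L₁` carries the row `[bound_lo (m+1) (nOf (m+1)), −bound_hi (m+1) (nOf (m+1))]`.
(`exists_forall_le_injOn_proj`: the windows fit into all large tori.) [cite: WangEtAl2024, §III] -/
theorem rows_eventually {t t' U : ℝ} {r : Site 2} (Clo : PairWindowCertTT' t t' U r 1)
    (Chi : PairWindowCertTT' t t' U r (-1)) (N nOf : ℕ → ℕ) (hN : ∀ L, N L = 2 * nOf L)
    (hcap : ∀ L, nOf L ≤ Fintype.card (FermionTorus 2 L)) {L₀ : ℕ}
    (hu : ∀ L : ℕ, L₀ ≤ L → groundEnergy (hubbardTorusTT' L t t' U) (N L) / (L : ℝ) ^ 2 ≤ min Clo.u Chi.u) :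
    ∃ L₁ : ℕ, ∀ m : ℕ, L₁ ≤ m + 1 →
      ∃ W : PairCorrWindowCert (fun L => hubbardTorusTT' L t t' U) N (m + 1) r,
        W.lo = Clo.bound (m + 1) (nOf (m + 1)) ∧ W.hi = -Chi.bound (m + 1) (nOf (m + 1)) := by
  obtain ⟨La, hLa⟩ := exists_forall_le_injOn_proj (thicken Clo.Λ' 1)
  obtain ⟨Lb, hLb⟩ := exists_forall_le_injOn_proj (thicken Chi.Λ' 1)
  refine ⟨max 3 (max L₀ (max La Lb)), fun m hm => ?_⟩
  simp only [max_le_iff] at hm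
  obtain ⟨h3, hL0, hLa', hLb'⟩ := hm
  have hE := hu (m + 1) hL0
  rw [hN] at hE
  exact ⟨rowOfCertificates Clo Chi m h3 (hLa _ hLa') (hLb _ hLb') (hN (m + 1)) (hcap (m + 1))
      (hE.trans (min_le_left _ _)) (hE.trans (min_le_right _ _)),
    rowOfCertificates_lo_hi Clo Chi m h3 (hLa _ hLa') (hLb _ hLb') (hN (m + 1)) (hcap (m + 1))
      (hE.trans (min_le_left _ _)) (hE.trans (min_le_right _ _))⟩

end

end Summit.HubbardSuperconductivity.HubbardLadder
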